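import Mathlib.Order.Filter.AtTopBot.Basic
import Mathlib.Algebra.Ring.Periodic
import Mathlib.Topology.EMetricSpace.Lipschitz
import Literature.Analysis.FunctionSpaces.Complexify
import Literature.Analysis.FunctionSpaces.FlatTorus
import Literature.Analysis.FunctionSpaces.TorusCalculus
import Literature.Analysis.FunctionSpaces.TorusSobolevNorm
import Literature.Analysis.FunctionSpaces.TorusFluidGlue
import Literature.Analysis.FluidPDE.WeakSolution
import Literature.Analysis.FluidPDE.LerayHopf
import Literature.Analysis.FluidPDE.TurbWave0
import Literature.Analysis.FluidPDE.ZerothLaw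
import HarnessLib

/-!
# AnomalousDissipation — problem statement (D-0007: predetermined problem; this file is CREATED BY THE OPERATOR via docs/m5/create_problems.py, never proposed by agents)

Prop-valued definitions (main statement + variants), assembled by the M5 migration from:
* `harness21/H21/H21/Statements/Turb/ZerothLaw.lean` (1 defs)
-/

-- provenance: harness21/H21/H21/Statements/Turb/ZerothLaw.lean @ a02c0a0 (interim HEAD d8f2665); M5 mechanical rewrite; audited 2026-08-13 (refuter audit, no change to the Prop)
open MeasureTheory Filter Topology Set
open scoped ENNReal NNReal

noncomputable section

namespace Literature.Turb

/-- The physical flat unit torus `T³ = (ℝ/ℤ)³` (local notation). -/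
local notation "𝕋³" => UnitAddTorus (Fin 3)
/-- Velocity values on `T³` (local notation). -/
local notation "E³" => EuclideanSpace ℝ (Fin 3)

/-! ### turb.S01: the zeroth law (open) -/

section ZerothLaw

/-- **turb.S01** (the zeroth law of turbulence for smooth steady forcing; summit `S`;
Kolmogorov 1941a,c; Frisch 1995, §5.2 ("energy dissipation per unit mass … finite positive limit"
as `ν → 0` with all other control parameters fixed); mathematically precise steady-forcing form:
Bruè–De Lellis, CMP 2023, §1 eq. (1.2) with Questions 2.1 (force independent of `ν`) and 2.2
(force independent of time), transplanted to the long-time-average framework of Doering–Foias,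
JFM 467 (2002) §2 and Cheskidov, arXiv:2311.04182 §1.2 (`ε = ⟨ν‖∇u‖₂²⟩`, `U² = ⟨‖u‖₂²⟩`,
Leray–Hopf solutions, `limsup_{Re→∞} εℓ/U³ > 0`); *open*).
There exist a force `f ∈ C^∞(T³; ℝ³)`, divergence free and mean zero, time- and
`ν`-independent, viscosities `νⱼ > 0` with `νⱼ → 0`, and global Leray–Hopf solutions `uⱼ` of the
Navier–Stokes equations with viscosity `νⱼ` forced by `f` (from some finite-energy data `u₀ⱼ`),
such that the mean energies are bounded, `supⱼ ⟨‖uⱼ‖₂²⟩ < ∞`, while the mean energy dissipation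
rates stay bounded away from zero, `infⱼ νⱼ ⟨‖∇uⱼ‖₂²⟩ > 0`; here `⟨g⟩ = limsup_{T→∞} T⁻¹ ∫₀ᵀ g`
and `‖∇uⱼ(t)‖₂²` is spectral (`Turb.meanEnergy`, `Turb.meanDissipation`, ε-form). With `f`
fixed, `U` bounded and `ε` bounded below give Kolmogorov's dimensionless form
`β = εℓ/U³ ≥ β₀ > 0`. The bounded-energy clause is essential: without it the laminar shear
flows `u = f/(4π²ν)` (`f` a Stokes eigenfield) have `ε = ‖∇f‖₂²/(16π⁴ν) → ∞`.
Junk notes: `⟨·⟩` is a real `limsup` (value `0` on unbounded Cesàro means; Leray–Hopf energies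
are bounded in time, so not attainable), `ENNReal.toReal` (`0` at the null set of times where
`‖∇u‖₂² = ∞`). [cite: Kolmogorov1941, a c] [cite: Frisch1995, §5.2] [cite: BrueDeLellis2023, §1 (1.2), Q. 2.1–2.2] [problem: turb] -/
def ZerothLaw : Prop :=
  ∃ f : 𝕋³ → E³, Literature.Analysis.FunctionSpaces.Torus.IsSmooth f ∧ Literature.Analysis.FunctionSpaces.Torus.IsDivFree f ∧ Literature.Analysis.FunctionSpaces.Torus.HasZeroMean f ∧
    ∃ (ν : ℕ → ℝ) (u₀ : ℕ → 𝕋³ → E³) (u : ℕ → ℝ → 𝕋³ → E³),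
      (∀ j, 0 < ν j) ∧ Tendsto ν atTop (𝓝 0) ∧
      (∀ j, Literature.Analysis.FluidPDE.Torus.IsGlobalLerayHopf (ν j) (fun _ => f) (u₀ j) (u j)) ∧
      (∃ E : ℝ, ∀ j, Literature.Analysis.FluidPDE.meanEnergy (u j) ≤ E) ∧
      ∃ ε : ℝ, 0 < ε ∧ ∀ j, ε ≤ Literature.Analysis.FluidPDE.meanDissipation (ν j) (u j)

end ZerothLaw

end Literature.Turb

end

/-- The `AnomalousDissipation` problem statement (D-0010; canonical root-level name checked by the gate) := `Literature.Turb.ZerothLaw`. [problem: turb] -/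
def AnomalousDissipation : Prop := Literature.Turb.ZerothLaw
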